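import Mathlib
import HarnessLib

/-!
# `DensityLadder.SeparatedTowerDensityLine` (item stmt-RiemannHypothesis-24918) — finiteness and
# counting of g-separated ordinates in a bounded range (bookkeeping for stub S1)

LINE L57 «sieve sight above the density line» (rh-idea-10 g1), crux K1 `SeparatedTowerDensityLine`,
stub S1 of the registered skeleton `Birth.lean` (seat memo `MEANVALUE-SECOND-READ.md` on
stmt-RiemannHypothesis-24918).  The tower's ordinates are pairwise `≥ g` apart, so the tower zeros
with `|Im ρ| ≤ R` form a FINITE set of at most `2R/g + 1` elements: this makes every `Set.ncard` in
the crux honest, gives the trivial ceiling `e ≤ 1` of the referee's pre-vet note, and provides the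
finite truncations `F = {tower, |γ| ≤ R}` over which the mean square is expanded.
Cell rh-split, seat rh-split-prover-l57 g0.  RH-free, ζ-free; FRONTIER bookkeeping; nothing here
bears on the truth of RH.
-/

set_option linter.dupNamespace false

noncomputable section

open Set

namespace Summit.RiemannHypothesis.RiemannHypothesis.Theorems.DensityLadderSeparatedTowerCount

/-- **g-separated ordinates in `[−R, R]` are finitely many, at most `2R/g + 1`.**  If the indices
satisfying `P` have pairwise `g`-separated ordinates (`g > 0`), then for every `R ≥ 0` the set
`{i | P i ∧ |γ_i| ≤ R}` is finite with `ncard ≤ 2R/g + 1`. [folklore] -/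
theorem finite_and_ncard_le_of_separated {ι : Type} (γ : ι → ℝ) (P : ι → Prop) {g : ℝ} (hg : 0 < g)
    (hsep : ∀ i j : ι, P i → P j → i ≠ j → g ≤ |γ i - γ j|) {R : ℝ} (hR : 0 ≤ R) :
    {i : ι | P i ∧ |γ i| ≤ R}.Finite ∧ (({i : ι | P i ∧ |γ i| ≤ R}.ncard : ℝ) ≤ 2 * R / g + 1) := by
  classical
  set A : Set ι := {i : ι | P i ∧ |γ i| ≤ R} with hA
  -- the injection `i ↦ ⌊(γ_i + R)/g⌋₊` into `{0, …, ⌊2R/g⌋}`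
  set k : ι → ℕ := fun i ↦ ⌊(γ i + R) / g⌋₊ with hk
  have hy : ∀ i ∈ A, 0 ≤ (γ i + R) / g ∧ (γ i + R) / g ≤ 2 * R / g := by
    intro i hi
    have h := abs_le.1 hi.2
    exact ⟨div_nonneg (by linarith) hg.le, by rw [div_le_div_iff_of_pos_right hg]; linarith⟩
  have hinj : Set.InjOn k A := by
    intro i hi j hj hij
    by_contra hne
    have hs := hsep i j hi.1 hj.1 hne
    obtain ⟨hyi, _⟩ := hy i hi
    obtain ⟨hyj, _⟩ := hy j hj
    rcases le_or_gt (γ i) (γ j) with hle | hlt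
    · rw [abs_of_nonpos (by linarith)] at hs
      have h2 : (γ i + R) / g + 1 ≤ (γ j + R) / g := by
        rw [div_add_one hg.ne', div_le_div_iff_of_pos_right hg]; linarith
      have h3 := Nat.floor_le_floor h2
      rw [Nat.floor_add_one hyi] at h3
      simp only [hk] at hij
      omega
    · rw [abs_of_pos (by linarith)] at hs
      have h2 : (γ j + R) / g + 1 ≤ (γ i + R) / g := by
        rw [div_add_one hg.ne', div_le_div_iff_of_pos_right hg]; linarith
      have h3 := Nat.floor_le_floor h2
      rw [Nat.floor_add_one hyj] at h3
      simp only [hk] at hij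
      omega
  have hmaps : Set.MapsTo k A (↑(Finset.range (⌊2 * R / g⌋₊ + 1)) : Set ℕ) := by
    intro i hi
    rw [Finset.coe_range, Set.mem_Iio, Nat.lt_add_one_iff]
    exact Nat.floor_le_floor (hy i hi).2
  have hfin : A.Finite :=
    Set.Finite.of_finite_image ((Finset.finite_toSet _).subset hmaps.image_subset) hinj
  refine ⟨hfin, ?_⟩
  have hcard : A.ncard ≤ (Finset.range (⌊2 * R / g⌋₊ + 1)).card := by
    rw [← Set.ncard_coe_finset]
    exact Set.ncard_le_ncard_of_injOn k hmaps hinj (Finset.finite_toSet _)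
  rw [Finset.card_range] at hcard
  have hfl : (⌊2 * R / g⌋₊ : ℝ) ≤ 2 * R / g := Nat.floor_le (by positivity)
  calc (A.ncard : ℝ) ≤ ((⌊2 * R / g⌋₊ + 1 : ℕ) : ℝ) := by exact_mod_cast hcard
    _ ≤ 2 * R / g + 1 := by push_cast; linarith

end Summit.RiemannHypothesis.RiemannHypothesis.Theorems.DensityLadderSeparatedTowerCount

end
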